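import Summits.Ventures.DiscreteObjects.Hadamard.AutomorphismTransfer668

/-!
# The code of a Hadamard matrix modulo a prime `q ∥ n` is self-dual and invariant under signed automorphisms (kernel)

Framing: lottery ticket; floor = certified bounds/negative ranges.

Cell pub-namedobj (venture DiscreteObjects), target (H), hadamard gen 15.  Matrix-level version of the first step of Lander's
method (Symmetric Designs: An Algebraic Approach, 1983, §2.3 / Thm 2.12: the code of a symmetric design modulo `p ∥ n` is
self-dual), for an integer matrix `H` with `H Hᵀ = n·1` (a Hadamard matrix of order `n`; at `n = 668` take `q = 167`, and
every order `4q` with `q` an odd prime qualifies) and a prime `q` with `q ∣ n`, `q² ∤ n`, writing `H̄` for `H mod q`: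
* `hadamard_lift_modq` — LIFTING LEMMA: `H̄ v = 0 ⇒ v = H̄ᵀ w` for some `w` (lift to `ℤ`: `H ṽ = q w̃`, then
  `Hᵀ H ṽ = n ṽ = q Hᵀ w̃`, cancel `q`, and `n/q` is a unit mod `q`);
* `hadamard_code_modq_selfDual` — the code `C = ker H̄ ⊂ 𝔽_qⁿ` is SELF-DUAL for the dot product: `H̄ v = 0 ↔ v ⊥ ker H̄`;
* `signedPullback_mulVec`, `signedPullback_pow_mulVec`, `signedPullback_isometry`, `signedPullback_pow_eq_one` — the signed
  pull-back matrix `Kt j k = [k = κ j]·e j` of a signed permutation `(κ, e)` (`(Kt v) j = e j · v (κ j)`, the transpose =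
  inverse of the signed permutation matrix) is an isometry of the dot product with `Kt^{2M} = 1` when `κ^M = 1`;
* `hadamard_code_modq_signedAut` — for a signed automorphism `(π, κ, d, e)` of `H` (`IsSignedAut`: `H (π i) (κ j) = d i e j H i j`)
  the code `ker H̄` is invariant under the column pull-back `Kt`: `H̄ (Kt v) = 0` whenever `H̄ v = 0`
  (indeed `(H Kt v) i = d i (H v) (π i)`).
With `IsometryCodeParity` this gives the even-multiplicity theorem `HadamardSignedAutParity`.  Ours; no `sorry`; reference for the
method [cite: book:lander1983-symmetric-designs-algebraic-approach, Thm 2.12 p.71].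
-/

open Finset BigOperators Matrix

namespace Summit.Ventures.DiscreteObjects.Hadamard

variable {ι : Type*} [Fintype ι] [DecidableEq ι]

section lift
variable (H : Matrix ι ι ℤ)

/-- **Lifting lemma.**  If `Hᵀ H = n·1`, `q ∣ n`, `q² ∤ n` (`q` prime) and `H̄ v = 0` over `ZMod q`, then `v = H̄ᵀ w`
for some `w`. -/
theorem hadamard_lift_modq {n : ℤ} (hHt : Hᵀ * H = n • (1 : Matrix ι ι ℤ)) {q : ℕ} [Fact q.Prime]
    (hqn : (q : ℤ) ∣ n) (hq2 : ¬ (q : ℤ) ^ 2 ∣ n) (v : ι → ZMod q)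
    (hv : H.map (Int.castRingHom (ZMod q)) *ᵥ v = 0) :
    ∃ w : ι → ZMod q, (H.map (Int.castRingHom (ZMod q)))ᵀ *ᵥ w = v := by
  -- integer lift of v
  set vt : ι → ℤ := fun j => ((v j).val : ℤ) with hvt
  have hcast : ∀ j, ((vt j : ℤ) : ZMod q) = v j := fun j => by
    simp only [hvt, Int.cast_natCast, ZMod.natCast_zmod_val]
  -- H vt ≡ 0 (mod q)
  have hdiv : ∀ i, (q : ℤ) ∣ (H *ᵥ vt) i := by
    intro i
    rw [← ZMod.intCast_zmod_eq_zero_iff_dvd]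
    have e := congrFun hv i
    simp only [Pi.zero_apply, Matrix.mulVec, dotProduct, Matrix.map_apply, eq_intCast] at e
    simp only [Matrix.mulVec, dotProduct, Int.cast_sum, Int.cast_mul, hcast]
    exact e
  -- H vt = q • wt
  set wt : ι → ℤ := fun i => (H *ᵥ vt) i / q with hwt
  have hHvt : H *ᵥ vt = (q : ℤ) • wt := by
    funext i
    rw [Pi.smul_apply, smul_eq_mul, hwt]
    exact (Int.mul_ediv_cancel' (hdiv i)).symm
  -- n • vt = q • Hᵀ wt
  have hnq : n • vt = (q : ℤ) • (Hᵀ *ᵥ wt) := by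
    have e : Hᵀ *ᵥ (H *ᵥ vt) = n • vt := by
      rw [Matrix.mulVec_mulVec, hHt, Matrix.smul_mulVec, Matrix.one_mulVec]
    rw [← e, hHvt, Matrix.mulVec_smul]
  obtain ⟨n₁, hn₁⟩ := hqn
  have hq0 : (q : ℤ) ≠ 0 := by exact_mod_cast (Fact.out : q.Prime).ne_zero
  have hvt_eq : ∀ j, n₁ * vt j = (Hᵀ *ᵥ wt) j := by
    intro j
    have e := congrFun hnq j
    simp only [Pi.smul_apply, smul_eq_mul, hn₁] at e
    apply mul_left_cancel₀ hq0
    rw [← mul_assoc]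
    exact e
  -- n₁ = n / q is a unit mod q
  have hn₁0 : (n₁ : ZMod q) ≠ 0 := by
    intro h0
    rw [ZMod.intCast_zmod_eq_zero_iff_dvd] at h0
    apply hq2
    rw [hn₁, pow_two]
    exact mul_dvd_mul_left _ h0
  refine ⟨fun i => (n₁ : ZMod q)⁻¹ * (wt i : ZMod q), ?_⟩
  funext j
  have e := congrArg (Int.cast : ℤ → ZMod q) (hvt_eq j)
  rw [Int.cast_mul, hcast] at e
  simp only [Matrix.mulVec, dotProduct, Matrix.transpose_apply, Int.cast_sum, Int.cast_mul] at e
  simp only [Matrix.mulVec, dotProduct, Matrix.transpose_apply, Matrix.map_apply, eq_intCast]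
  calc ∑ i, (H i j : ZMod q) * ((n₁ : ZMod q)⁻¹ * (wt i : ZMod q))
      = (n₁ : ZMod q)⁻¹ * ∑ i, (H i j : ZMod q) * (wt i : ZMod q) := by
        rw [Finset.mul_sum]
        exact Finset.sum_congr rfl fun i _ => by ring
    _ = (n₁ : ZMod q)⁻¹ * ((n₁ : ZMod q) * v j) := by rw [← e]
    _ = v j := by rw [← mul_assoc, inv_mul_cancel₀ hn₁0, one_mul]

/-- `H̄ H̄ᵀ = 0` modulo `q ∣ n` -/
lemma hadamard_modq_mul_transpose {n : ℤ} (hH : H * Hᵀ = n • (1 : Matrix ι ι ℤ)) {q : ℕ} (hqn : (q : ℤ) ∣ n) :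
    H.map (Int.castRingHom (ZMod q)) * (H.map (Int.castRingHom (ZMod q)))ᵀ = 0 := by
  rw [← Matrix.transpose_map, ← Matrix.map_mul, hH]
  ext i j
  rw [Matrix.map_apply, Matrix.smul_apply, Matrix.zero_apply, smul_eq_mul, map_mul, eq_intCast,
    (ZMod.intCast_zmod_eq_zero_iff_dvd n q).mpr hqn, zero_mul]

/-- **Self-duality of the code `ker H̄`.**  With `H Hᵀ = n·1`, `q ∣ n`, `q² ∤ n`: `H̄ v = 0 ↔ v ⊥ ker H̄`. -/
theorem hadamard_code_modq_selfDual {n : ℤ} (hH : H * Hᵀ = n • (1 : Matrix ι ι ℤ)) {q : ℕ} [Fact q.Prime]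
    (hqn : (q : ℤ) ∣ n) (hq2 : ¬ (q : ℤ) ^ 2 ∣ n) (v : ι → ZMod q) :
    H.map (Int.castRingHom (ZMod q)) *ᵥ v = 0 ↔
      ∀ c, H.map (Int.castRingHom (ZMod q)) *ᵥ c = 0 → v ⬝ᵥ c = 0 := by
  set Hb := H.map (Int.castRingHom (ZMod q)) with hHb
  have hn : n ≠ 0 := by
    rintro rfl
    exact hq2 (dvd_zero _)
  have hHt : Hᵀ * H = n • (1 : Matrix ι ι ℤ) := transpose_mul_self_of_mul_transpose H n hn hH
  have h0 : Hb * Hbᵀ = 0 := hadamard_modq_mul_transpose H hH hqn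
  constructor
  · intro hv c hc
    obtain ⟨w, rfl⟩ := hadamard_lift_modq H hHt hqn hq2 v hv
    obtain ⟨w', rfl⟩ := hadamard_lift_modq H hHt hqn hq2 c hc
    rw [Matrix.mulVec_transpose, ← Matrix.dotProduct_mulVec, Matrix.mulVec_mulVec, h0, Matrix.zero_mulVec,
      dotProduct_zero]
  · intro h'
    funext i
    have e := h' (Hbᵀ *ᵥ Pi.single i 1) (by rw [Matrix.mulVec_mulVec, h0, Matrix.zero_mulVec])
    rw [Matrix.dotProduct_mulVec, Matrix.vecMul_transpose, dotProduct_single, mul_one] at e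
    rw [Pi.zero_apply]
    exact e

end lift

section pullback
variable {F : Type*} [CommRing F]

/-- the signed pull-back matrix acts by `(Kt v) j = e j · v (κ j)` -/
theorem signedPullback_mulVec (κ : Equiv.Perm ι) (ee : ι → F) (Kt : Matrix ι ι F)
    (hKt : Kt = Matrix.of fun j k => if k = κ j then ee j else 0) (v : ι → F) (j : ι) :
    (Kt *ᵥ v) j = ee j * v (κ j) := by
  rw [hKt]
  simp only [Matrix.mulVec, dotProduct, Matrix.of_apply]
  rw [Finset.sum_eq_single (κ j)]
  · rw [if_pos rfl]
  · intro k _ hk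
    rw [if_neg hk, zero_mul]
  · intro h
    exact absurd (Finset.mem_univ _) h

/-- powers of the signed pull-back: `(Kt^m v) j = (∏_{i<m} e (κ^i j)) · v (κ^m j)` -/
theorem signedPullback_pow_mulVec (κ : Equiv.Perm ι) (ee : ι → F) (Kt : Matrix ι ι F)
    (hKt : Kt = Matrix.of fun j k => if k = κ j then ee j else 0) (m : ℕ) (v : ι → F) (j : ι) :
    ((Kt ^ m) *ᵥ v) j = (∏ i ∈ range m, ee ((κ ^ i) j)) * v ((κ ^ m) j) := by
  induction m generalizing v j with
  | zero => simp
  | succ m ih =>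
    rw [pow_succ, ← Matrix.mulVec_mulVec, ih, signedPullback_mulVec κ ee Kt hKt, Finset.prod_range_succ,
      pow_succ', Equiv.Perm.mul_apply]
    ring

/-- the signed pull-back is an isometry of the dot product when the signs square to `1` -/
theorem signedPullback_isometry (κ : Equiv.Perm ι) (ee : ι → F) (hee : ∀ j, ee j * ee j = 1) (Kt : Matrix ι ι F)
    (hKt : Kt = Matrix.of fun j k => if k = κ j then ee j else 0) (v w : ι → F) :
    (Kt *ᵥ v) ⬝ᵥ (Kt *ᵥ w) = v ⬝ᵥ w := by
  simp only [dotProduct, signedPullback_mulVec κ ee Kt hKt]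
  calc ∑ j, ee j * v (κ j) * (ee j * w (κ j)) = ∑ j, v (κ j) * w (κ j) :=
        Finset.sum_congr rfl fun j _ => by rw [show ee j * v (κ j) * (ee j * w (κ j)) =
          (ee j * ee j) * (v (κ j) * w (κ j)) by ring, hee j, one_mul]
    _ = ∑ j, v j * w j := Equiv.sum_comp κ (fun j => v j * w j)

/-- `Kt^{2M} = 1` when `κ^M = 1` (the `M`-th power is a diagonal `±1` matrix) -/
theorem signedPullback_pow_eq_one (κ : Equiv.Perm ι) (ee : ι → F) (hee : ∀ j, ee j * ee j = 1) (Kt : Matrix ι ι F)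
    (hKt : Kt = Matrix.of fun j k => if k = κ j then ee j else 0) {M : ℕ} (hκM : ∀ j, (κ ^ M) j = j) :
    Kt ^ (2 * M) = 1 := by
  have hsq : ∀ j, (∏ i ∈ range M, ee ((κ ^ i) j)) * (∏ i ∈ range M, ee ((κ ^ i) j)) = 1 := by
    intro j
    rw [← Finset.prod_mul_distrib]
    exact Finset.prod_eq_one fun i _ => hee _
  have hprod : ∀ j, ∏ i ∈ range (2 * M), ee ((κ ^ i) j) = 1 := by
    intro j
    rw [two_mul, Finset.prod_range_add]
    have e : ∏ i ∈ range M, ee ((κ ^ (M + i)) j) = ∏ i ∈ range M, ee ((κ ^ i) j) :=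
      Finset.prod_congr rfl fun i _ => by rw [add_comm, pow_add, Equiv.Perm.mul_apply, hκM]
    rw [e, hsq]
  have h2M : ∀ j, (κ ^ (2 * M)) j = j := fun j => by rw [two_mul, pow_add, Equiv.Perm.mul_apply, hκM, hκM]
  apply Matrix.toLin'.injective
  refine LinearMap.ext fun v => funext fun j => ?_
  rw [Matrix.toLin'_apply, Matrix.toLin'_one, LinearMap.id_apply, signedPullback_pow_mulVec κ ee Kt hKt, hprod, h2M,
    one_mul]

end pullback

section signedAut
open Literature.Combinatorics.Designs.GoethalsSeidel (IsHadamardMatrix)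

/-- **Invariance of the code under signed automorphisms.**  For a signed automorphism `(π, κ, d, e)` of `H` and the column
pull-back `Kt j k = [k = κ j]·e j` over `ZMod q`: `(H̄ (Kt v)) i = d i · (H̄ v) (π i)`; in particular `ker H̄` is
`Kt`-invariant. -/
theorem hadamard_modq_mulVec_signedPullback (H : Matrix ι ι ℤ) {π κ : Equiv.Perm ι} {d e : ι → ℤ}
    (hA : IsSignedAut H π κ d e) {q : ℕ} (Kt : Matrix ι ι (ZMod q))
    (hKt : Kt = Matrix.of fun j k => if k = κ j then ((e j : ℤ) : ZMod q) else 0) (v : ι → ZMod q) (i : ι) :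
    (H.map (Int.castRingHom (ZMod q)) *ᵥ (Kt *ᵥ v)) i =
      ((d i : ℤ) : ZMod q) * (H.map (Int.castRingHom (ZMod q)) *ᵥ v) (π i) := by
  have hd := hA.1
  have hH := hA.2.2
  have h1 : ∀ (w : ι → ZMod q) (i : ι),
      (H.map (Int.castRingHom (ZMod q)) *ᵥ w) i = ∑ j, ((H i j : ℤ) : ZMod q) * w j := fun w i => rfl
  rw [h1, h1, Finset.mul_sum]
  simp_rw [signedPullback_mulVec κ (fun j => ((e j : ℤ) : ZMod q)) Kt hKt v]
  rw [← Equiv.sum_comp κ (fun k => ((d i : ℤ) : ZMod q) * (((H (π i) k : ℤ) : ZMod q) * v k))]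
  refine Finset.sum_congr rfl fun j _ => ?_
  have hd2 : ((d i : ℤ) : ZMod q) * ((d i : ℤ) : ZMod q) = 1 := by
    rw [← Int.cast_mul, pm_mul_self (hd i), Int.cast_one]
  simp only [hH i j, Int.cast_mul]
  linear_combination (-(((e j : ℤ) : ZMod q) * ((H i j : ℤ) : ZMod q) * v (κ j))) * hd2

/-- the code `ker H̄` is invariant under the column pull-back of a signed automorphism -/
theorem hadamard_code_modq_signedAut (H : Matrix ι ι ℤ) {π κ : Equiv.Perm ι} {d e : ι → ℤ}
    (hA : IsSignedAut H π κ d e) {q : ℕ} (Kt : Matrix ι ι (ZMod q))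
    (hKt : Kt = Matrix.of fun j k => if k = κ j then ((e j : ℤ) : ZMod q) else 0) (v : ι → ZMod q)
    (hv : H.map (Int.castRingHom (ZMod q)) *ᵥ v = 0) :
    H.map (Int.castRingHom (ZMod q)) *ᵥ (Kt *ᵥ v) = 0 := by
  funext i
  rw [hadamard_modq_mulVec_signedPullback H hA Kt hKt v i, hv, Pi.zero_apply, mul_zero, Pi.zero_apply]

omit [Fintype ι] [DecidableEq ι] in
/-- signs of a signed automorphism square to one modulo `q` -/
lemma signedAut_sign_sq {H : Matrix ι ι ℤ} {π κ : Equiv.Perm ι} {d e : ι → ℤ} (hA : IsSignedAut H π κ d e)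
    (q : ℕ) (j : ι) : ((e j : ℤ) : ZMod q) * ((e j : ℤ) : ZMod q) = 1 := by
  rw [← Int.cast_mul, pm_mul_self (hA.2.1 j), Int.cast_one]

end signedAut

end Summit.Ventures.DiscreteObjects.Hadamard
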